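/-
Copyright (c) 2026. All rights reserved.
Released under Apache 2.0 license as described in the file LICENSE.
Authors: abc-iut cell, seat abc-iut-w5-d226 (gen 2; sub-DAG `AbsTopIII:Prop4.2` rows P42.i/L06–L07,
P42.i/L10–L11, P42.ii/L13–L14 of plan/L4/SUBDAG-AbsTopIII-Prop42.md at the MODEL, monoid types; part 2/2).
-/
import Literature.AnabelianGeometry.AbsoluteAnabelian.ArchimedeanHolMonoidPairs
import Literature.AnabelianGeometry.AbsoluteAnabelian.ArchimedeanLogFrobeniusModel
import Literature.AnabelianGeometry.AbsoluteAnabelian.RigidFunctors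
import HarnessLib

/-!
# [AbsTopIII] Def 4.1 (iii)(iv), Prop 4.2 (i)(ii) at the model for the MONOID types `T ∈ {TM, TLG, TCG}`

S. Mochizuki, *Topics in absolute anabelian geometry III*, §4: Def 4.1 (iii) p. 103, (iv) pp. 103–105,
Prop 4.2 (i)(ii) pp. 105–106 of the author's kurims manuscript (lit key `paper:url-5493eb38cbb7`, read on
the page; bib key `MochizukiAbsTopIII2015`).  Sequel to `ArchimedeanHolMonoidPairs.lean` (the categories
`𝒞^hol_T = HolMonoidPair 𝔄 T`, `T ∈ {TM, TLG, TCG}`, over abc-iut-L4-t10's interface `𝔄 : AutHolFieldFunctor`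
and `𝒞^hol_TF = HolTFPair 𝔄`); abc-iut-L4-t10's `ArchimedeanLogFrobeniusModel.lean` supplies `𝔩𝔬𝔤_{TF,TF}`
(`HolTFPair.logFunctor`, the identity in the tree's realisation `k~ = (k, +)`), `LinHol`, `κ_LH`, `φ_LH`,
`η_LH` and the case `T = TF` of everything below.  Here, for the monoid types:

* **Prop 4.2 (i)**: `Hom_{𝒞^hol_T} ≃ Hom_EA` (`homEquivBase`); every morphism is a `T`-isomorphism — `φ_M`
  is a bijection with continuous inverse, the restriction of the homeomorphism `κ₂⁻¹ ∘ 𝒜_{φ_𝕏} ∘ κ₁`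
  (`Hom.arith_bijective`, `Hom.continuous_arith_symm`: **`𝒞^hol_T = 𝒞̲^hol_T`**); the natural functor
  `𝒞^hol_T → EA` of Def 4.1 (iii) (`toEA`) and `𝕏 ↦ (𝕏 ↶ M_T(𝒜_𝕏))` (`ofEA`) are quasi-inverse equivalences
  (`etaEA`, `ofEA_isEquivalence`, `toEA_isEquivalence`); the displayed bijection
  `Isom_{𝒞^hol_T}((𝕏 ↶ M),(𝕏* ↶ M*)) ⥲ Isom_EA(𝕏, 𝕏*)` (`mapIso_toEA_bijective`); and the id-rigidity clause
  REDUCED to `EA` (`isIdRigid_of_isIdRigid_EA`) — the id-rigidity of `EA` itself (Lemma 4.3 slimness +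
  Cor 2.3 (i)) is NOT proved here (cf. abc-iut-L4-t10's `AutHolLogFrobeniusModelProofs`, abc-iut-w5-d215's
  `isIdRigid_of_isSlim`);
* Def 4.1 (iii): the natural functors `𝒞^hol_TF → 𝒞^hol_T` (`ofTF`; on morphisms the RESTRICTION of `φ_M`,
  `ofTF_map_arith_coe`; an equivalence, `ofTF_isEquivalence`) and `𝒞^hol_TM → 𝒞^hol_TLG` (groupification),
  `𝒞^hol_TM → 𝒞^hol_TCG` (invertible elements), `𝒞^hol_TLG → 𝒞^hol_TCG` (maximal compact subgroup) (`toTLG`,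
  `toTCG`, `unitsTCG`, instances of `changeType`: same structure-orbispace and CAF, arithmetic datum
  re-formed inside `k`, on morphisms restriction/extension of the one field isomorphism —
  `toTCG_map_arith_coe`, `toTLG_map_arith_coe`; compatible: `toTLG_comp_unitsTCG`, `ofTF_comp_changeType`);
* Def 4.1 (iv): `𝔩𝔬𝔤_{TF,T} :=` "`𝔩𝔬𝔤_{TF,TF}` [composed] with the various natural functors defined in (iii)"
  (`logTF`);
* **Prop 4.2 (ii)**: "the equivalence of categories `κ_LH : EA ⥲ LinHol` … determines a natural
  [1-]factorization `𝒞^hol_TF → 𝒞^hol_TM →^{𝔩𝔬𝔤_{TM,T}} 𝒞^hol_T` … of the log-Frobenius functors `𝔩𝔬𝔤_{TF,T}`"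
  — `𝔩𝔬𝔤_{TM,TF} := (𝒞^hol_TM → EA) ⋙ κ_LH ⋙ φ_LH ⋙ 𝔩𝔬𝔤_{TF,TF}` (`logTMTF`), `𝔩𝔬𝔤_{TM,T}` (`logTM`), the
  factorisation isomorphisms (`logFactorTF`, `logFactor`) — and "[when `T ∈ {TF, TM}`] the functor
  `𝔩𝔬𝔤_{T,T}` is isomorphic to the identity functor [hence … an equivalence]" for `T = TM` (`logTMIsoId`,
  `logTM_TM_isEquivalence`; also `logTM_isEquivalence` for every monoid `T`).

The `sB` full subcategories are not cut out (the interface `EA` carries no strictly-Belyi predicate).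
Refereed pre-IUT anabelian geometry; a MODEL over a named interface; nothing here bears on [IUTchIII]
Cor. 3.12 or takes a side; typed ≠ discharged except where a proof is given.
-/

set_option autoImplicit false

noncomputable section

namespace Literature.AnabelianGeometry.AbsoluteAnabelian

open _root_.CategoryTheory _root_.Topology

universe u

namespace HolMonoidPair

variable {𝔄 : AutHolFieldFunctor.{u}} {T : ArchPairType}

/-! ### Proposition 4.2 (i) for the monoid types -/

/-- **Prop 4.2 (i) at the model, morphism level** (`T ∈ {TM, TLG, TCG}`): morphisms
`(𝕏 ↶ M_T(k)) ⟶ (𝕐 ↶ M_T(k'))` of `𝒞^hol_T` are in bijection with the finite étale `𝕏 ⟶ 𝕐` via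
`(φ_𝕏, φ_M) ↦ φ_𝕏`. [cite: MochizukiAbsTopIII2015, Proposition 4.2 (i) p.105] -/
def homEquivBase (P Q : HolMonoidPair 𝔄 T) : (P ⟶ Q) ≃ (P.X ⟶ Q.X) where
  toFun φ := φ.base
  invFun f := Hom.ofBase P Q f
  left_inv φ := (Hom.eq_ofBase φ).symm
  right_inv _ := rfl

/-- The arithmetic part of a morphism is the restriction of `κ₂⁻¹ ∘ 𝒜_{φ_𝕏} ∘ κ₁`.
[cite: MochizukiAbsTopIII2015, Proposition 4.2 (i) p.106] -/
theorem Hom.arith_coe_eq_fieldIso {P Q : HolMonoidPair 𝔄 T} (φ : P ⟶ Q) (m : P.M) :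
    (φ.arith m : Q.k) = fieldIso P Q φ.base m :=
  Hom.arith_coe φ m

/-- **`𝒞^hol_T = 𝒞̲^hol_T`** (`T ∈ {TM, TLG, TCG}`): the arithmetic part of EVERY morphism of `T`-pairs is bijective
(the restriction of the field isomorphism `κ₂⁻¹ ∘ 𝒜_{φ_𝕏} ∘ κ₁`, which maps `M_T(k₁)` onto `M_T(k₂)`), i.e.
every morphism is a `T`-isomorphism. [cite: MochizukiAbsTopIII2015, Proposition 4.2 (i) p.105] -/
theorem Hom.arith_bijective {P Q : HolMonoidPair 𝔄 T} (φ : P ⟶ Q) : Function.Bijective φ.arith := by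
  have key : ∀ m : P.M, (φ.arith m : Q.k) = fieldIso P Q φ.base m := fun m => Hom.arith_coe φ m
  constructor
  · intro x y h
    apply Subtype.ext
    apply (fieldIso P Q φ.base).injective
    rw [← key, ← key, h]
  · intro n
    have hm : (fieldIso P Q φ.base).symm (n : Q.k) ∈ P.M := by
      rw [← fieldIso_mem_iff P Q φ.base, RingEquiv.apply_symm_apply]
      exact n.2
    refine ⟨⟨_, hm⟩, Subtype.ext ?_⟩
    rw [key]
    exact (fieldIso P Q φ.base).apply_symm_apply _

/-- The inverse of the arithmetic part of a morphism is the restriction of `(κ₂⁻¹ ∘ 𝒜_{φ_𝕏} ∘ κ₁)⁻¹`.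
[cite: MochizukiAbsTopIII2015, Proposition 4.2 (i) p.105] -/
theorem Hom.arith_symm_coe {P Q : HolMonoidPair 𝔄 T} (φ : P ⟶ Q) (n : Q.M) :
    ((Equiv.ofBijective φ.arith (Hom.arith_bijective φ)).symm n : P.k) =
      (fieldIso P Q φ.base).symm (n : Q.k) := by
  apply (fieldIso P Q φ.base).injective
  rw [RingEquiv.apply_symm_apply, ← Hom.arith_coe_eq_fieldIso φ]
  exact congrArg Subtype.val ((Equiv.ofBijective φ.arith (Hom.arith_bijective φ)).apply_symm_apply n)

/-- The arithmetic part of a morphism has a continuous inverse as well (it is the restriction of a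
homeomorphism), so it is an isomorphism of topological monoids.
[cite: MochizukiAbsTopIII2015, Proposition 4.2 (i) p.105] -/
theorem Hom.continuous_arith_symm {P Q : HolMonoidPair 𝔄 T} (φ : P ⟶ Q) :
    Continuous (Equiv.ofBijective φ.arith (Hom.arith_bijective φ)).symm := by
  have hmem : ∀ n : Q.M, (fieldIso P Q φ.base).symm (n : Q.k) ∈ P.M := fun n => by
    rw [← Hom.arith_symm_coe φ n]
    exact Subtype.coe_prop _
  have hc : Continuous fun n : Q.M => (⟨(fieldIso P Q φ.base).symm (n : Q.k), hmem n⟩ : P.M) :=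
    ((continuous_fieldIso_symm P Q φ.base).comp continuous_subtype_val).subtype_mk _
  exact hc.congr fun n => Subtype.ext (Hom.arith_symm_coe φ n).symm

variable (𝔄 T) in
/-- **Def 4.1 (iii): the natural functor `𝒞^hol_T → EA`**, "the assignment `(𝕏 ↶ M) ↦ 𝕏`".
[cite: MochizukiAbsTopIII2015, Definition 4.1 (iii) p.103] -/
def toEA : HolMonoidPair 𝔄 T ⥤ 𝔄.EA where
  obj P := P.X
  map φ := φ.base

/-- `(𝕏 ↶ M) ↦ 𝕏` on objects. [cite: MochizukiAbsTopIII2015, Definition 4.1 (iii) p.103] -/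
@[simp] theorem toEA_obj (P : HolMonoidPair 𝔄 T) : (toEA 𝔄 T).obj P = P.X := rfl
/-- `(φ_𝕏, φ_M) ↦ φ_𝕏` on morphisms. [cite: MochizukiAbsTopIII2015, Definition 4.1 (iii) p.103] -/
@[simp] theorem toEA_map {P Q : HolMonoidPair 𝔄 T} (φ : P ⟶ Q) : (toEA 𝔄 T).map φ = φ.base := rfl

variable (𝔄) in
/-- The model `T`-pair `(𝕏 ↶ M_T(𝒜_𝕏))` over `𝕏 ∈ Ob(EA)` with the tautological Kummer structure, functorially
in finite étale morphisms (the route `EA →^{κ_LH} LinHol → 𝒞^hol_TF → 𝒞^hol_T` of Prop 4.2 (ii) on objects).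
[cite: MochizukiAbsTopIII2015, Proposition 4.2 (ii) p.105] -/
def ofEA (hT : T.IsMonoidType) : 𝔄.EA ⥤ HolMonoidPair 𝔄 T where
  obj X := ⟨(HolTFPair.ofEA 𝔄).obj X, hT⟩
  map f := Hom.ofBase _ _ f
  map_id _ := Hom.ext_of_base rfl
  map_comp _ _ := Hom.ext_of_base rfl

/-- The structure-orbispace of `(𝕏 ↶ M_T(𝒜_𝕏))` is `𝕏`. [cite: MochizukiAbsTopIII2015, Proposition 4.2 (ii) p.105] -/
@[simp] theorem ofEA_obj_X (hT : T.IsMonoidType) (X : 𝔄.EA) : ((ofEA 𝔄 hT).obj X).X = X := rfl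
/-- `ofEA` on morphisms: structure part. [cite: MochizukiAbsTopIII2015, Proposition 4.2 (ii) p.105] -/
@[simp] theorem ofEA_map_base (hT : T.IsMonoidType) {X Y : 𝔄.EA} (f : X ⟶ Y) :
    ((ofEA 𝔄 hT).map f).base = f := rfl

/-- `(𝕏 ↶ M_T(𝒜_𝕏)) ↦ 𝕏` is the identity: `ofEA ⋙ toEA = 𝟭`. [cite: MochizukiAbsTopIII2015, Proposition 4.2 (i) p.105] -/
theorem ofEA_comp_toEA (hT : T.IsMonoidType) : ofEA 𝔄 hT ⋙ toEA 𝔄 T = 𝟭 𝔄.EA := rfl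

/-- The canonical isomorphism `(𝕏 ↶ M_T(𝒜_𝕏)) ≅ (𝕏 ↶ M_T(k))` over `id_𝕏` (arithmetic parts the restrictions of
`κ⁻¹`, `κ`). [cite: MochizukiAbsTopIII2015, Proposition 4.2 (i) p.105] -/
def etaIso (P : HolMonoidPair 𝔄 T) : (ofEA 𝔄 P.isMonoidType).obj P.X ≅ P where
  hom := Hom.ofBase _ _ (𝟙 P.X)
  inv := Hom.ofBase _ _ (𝟙 P.X)
  hom_inv_id := Hom.ext_of_base (by simp)
  inv_hom_id := Hom.ext_of_base (by simp)

/-- `(𝒞^hol_T → EA) ⋙ (𝕏 ↦ (𝕏 ↶ M_T(𝒜_𝕏))) ≅ 𝟭`, naturally in the pair.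
[cite: MochizukiAbsTopIII2015, Proposition 4.2 (i) p.105] -/
def etaEA (hT : T.IsMonoidType) : toEA 𝔄 T ⋙ ofEA 𝔄 hT ≅ 𝟭 (HolMonoidPair 𝔄 T) :=
  NatIso.ofComponents (fun P => etaIso P) (fun {P Q} φ => by
    apply Hom.ext_of_base
    change φ.base ≫ 𝟙 Q.X = 𝟙 P.X ≫ φ.base
    rw [Category.comp_id, Category.id_comp])

/-- **`𝕏 ↦ (𝕏 ↶ M_T(𝒜_𝕏))` is an equivalence `EA ⥲ 𝒞^hol_T`** with quasi-inverse `(𝕏 ↶ M) ↦ 𝕏` (`T ∈ {TM, TLG, TCG}`).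
[cite: MochizukiAbsTopIII2015, Proposition 4.2 (i) p.105] -/
theorem ofEA_isEquivalence (hT : T.IsMonoidType) : (ofEA 𝔄 hT).IsEquivalence :=
  Functor.IsEquivalence.mk' (toEA 𝔄 T) (eqToIso (ofEA_comp_toEA (𝔄 := 𝔄) hT).symm) (etaEA hT)

/-- `(𝕏 ↶ M) ↦ 𝕏` is an equivalence `𝒞^hol_T ⥲ EA`. [cite: MochizukiAbsTopIII2015, Proposition 4.2 (i) p.105] -/
theorem toEA_isEquivalence (hT : T.IsMonoidType) : (toEA 𝔄 T).IsEquivalence :=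
  Functor.IsEquivalence.mk' (ofEA 𝔄 hT) (etaEA hT).symm (eqToIso (ofEA_comp_toEA (𝔄 := 𝔄) hT))

/-- **Prop 4.2 (i) at the model** (`T ∈ {TM, TLG, TCG}`): "the natural functor of Definition 4.1, (iii),
induces a bijection `Isom_{𝒞^hol_T}((𝕏 ↶ M),(𝕏* ↶ M*)) ⥲ Isom_EA(𝕏, 𝕏*)` on sets of isomorphisms".
[cite: MochizukiAbsTopIII2015, Proposition 4.2 (i) p.105] -/
theorem mapIso_toEA_bijective (P Q : HolMonoidPair 𝔄 T) :
    Function.Bijective (fun φ : P ≅ Q => (toEA 𝔄 T).mapIso φ) := by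
  constructor
  · intro φ ψ h
    have hh : φ.hom.base = ψ.hom.base := by
      have := congrArg Iso.hom h
      simpa using this
    exact Iso.ext (Hom.ext_of_base hh)
  · intro f
    refine ⟨⟨Hom.ofBase P Q f.hom, Hom.ofBase Q P f.inv, ?_, ?_⟩, ?_⟩
    · apply Hom.ext_of_base
      change f.hom ≫ f.inv = 𝟙 P.X
      exact f.hom_inv_id
    · apply Hom.ext_of_base
      change f.inv ≫ f.hom = 𝟙 Q.X
      exact f.inv_hom_id
    · exact Iso.ext rfl

/-- **Prop 4.2 (i), id-rigidity clause, at the model** (`T ∈ {TM, TLG, TCG}`): "the categories `EA`,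
`𝒞^hol_T = 𝒞̲^hol_T` … are id-rigid" — if `EA` is id-rigid ("follows immediately from the slimness assertion
of Lemma 4.3", NOT proved here) then so is `𝒞^hol_T`, by the equivalence `EA ≌ 𝒞^hol_T` ("in light of the
bijectivity portion of assertion (i)"). [cite: MochizukiAbsTopIII2015, Proposition 4.2 (i) p.105] -/
theorem isIdRigid_of_isIdRigid_EA (hT : T.IsMonoidType) (hE : IsIdRigid 𝔄.EA) :
    IsIdRigid (HolMonoidPair 𝔄 T) :=
  haveI := ofEA_isEquivalence (𝔄 := 𝔄) hT
  isIdRigid_of_equivalence' (ofEA 𝔄 hT).asEquivalence hE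

/-- Non-vacuity: over any object of `EA`, `𝒞^hol_T` has an object. [cite: MochizukiAbsTopIII2015, Definition 4.1 (ii) p.102] -/
theorem nonempty_of (hT : T.IsMonoidType) (X : 𝔄.EA) : Nonempty (HolMonoidPair 𝔄 T) :=
  ⟨(ofEA 𝔄 hT).obj X⟩

/-! ### Def 4.1 (iii): the natural functors `𝒞^hol_TF → 𝒞^hol_TM → 𝒞^hol_TLG / 𝒞^hol_TCG`, `𝒞^hol_TLG → 𝒞^hol_TCG` -/

variable (𝔄) in
/-- **Def 4.1 (iii): the natural functor `𝒞^hol_TF → 𝒞^hol_T`** (`T ∈ {TM, TLG, TCG}`), `(𝕏 ↶ k) ↦ (𝕏 ↶ M_T(k))`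
"by taking the multiplicative monoid of nonzero elements of absolute value `≤ 1` of the arithmetic data"
(and then `M^gp`, `M^×`); on morphisms `φ_M ↦ φ_M|_{M_T(k)}` (`ofTF_map_arith_coe`).
[cite: MochizukiAbsTopIII2015, Definition 4.1 (iii) p.103] -/
def ofTF (hT : T.IsMonoidType) : HolTFPair 𝔄 ⥤ HolMonoidPair 𝔄 T where
  obj P := ⟨P, hT⟩
  map φ := Hom.ofBase _ _ φ.base
  map_id _ := Hom.ext_of_base rfl
  map_comp _ _ := Hom.ext_of_base rfl

/-- `𝒞^hol_TF → 𝒞^hol_T` keeps the structure-orbispace. [cite: MochizukiAbsTopIII2015, Definition 4.1 (iii) p.103] -/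
@[simp] theorem ofTF_obj_X (hT : T.IsMonoidType) (P : HolTFPair 𝔄) : ((ofTF 𝔄 hT).obj P).X = P.X := rfl
/-- `𝒞^hol_TF → 𝒞^hol_T` keeps the structure part of morphisms. [cite: MochizukiAbsTopIII2015, Definition 4.1 (iii) p.103] -/
@[simp] theorem ofTF_map_base (hT : T.IsMonoidType) {P Q : HolTFPair 𝔄} (φ : P ⟶ Q) :
    ((ofTF 𝔄 hT).map φ).base = φ.base := rfl

/-- `𝒞^hol_TF → 𝒞^hol_T` on morphisms RESTRICTS the field homomorphism `φ_M : k₁ → k₂` to `M_T(k₁) → M_T(k₂)`.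
[cite: MochizukiAbsTopIII2015, Definition 4.1 (iii) p.103] -/
theorem ofTF_map_arith_coe (hT : T.IsMonoidType) {P Q : HolTFPair 𝔄} (φ : P ⟶ Q)
    (m : (HolMonoidPair.mk P hT : HolMonoidPair 𝔄 T).M) :
    φ.arith m.1 = (((ofTF 𝔄 hT).map φ).arith m).1 :=
  HolTFPair.Hom.arith_apply φ m.1

/-- `𝒞^hol_TF → 𝒞^hol_T → EA` is `𝒞^hol_TF → EA`. [cite: MochizukiAbsTopIII2015, Definition 4.1 (iii) p.103] -/
theorem ofTF_comp_toEA (hT : T.IsMonoidType) : ofTF 𝔄 hT ⋙ toEA 𝔄 T = HolTFPair.toEA 𝔄 := rfl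

/-- `𝒞^hol_TF → 𝒞^hol_T` is an equivalence (both categories are equivalent to `EA` over it).
[cite: MochizukiAbsTopIII2015, Proposition 4.2 (i) p.105] -/
theorem ofTF_isEquivalence (hT : T.IsMonoidType) : (ofTF 𝔄 hT).IsEquivalence := by
  haveI := toEA_isEquivalence (𝔄 := 𝔄) hT
  haveI := HolTFPair.ofEA_isEquivalence 𝔄
  haveI : (HolTFPair.toEA 𝔄).IsEquivalence :=
    Functor.IsEquivalence.mk' (HolTFPair.ofEA 𝔄) (HolTFPair.etaEA 𝔄).symm
      (eqToIso (HolTFPair.ofEA_comp_toEA (𝔄 := 𝔄)))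
  haveI : (ofTF 𝔄 hT ⋙ toEA 𝔄 T).IsEquivalence := by
    rw [ofTF_comp_toEA]; infer_instance
  exact Functor.isEquivalence_of_comp_right (ofTF 𝔄 hT) (toEA 𝔄 T)

variable (𝔄) in
/-- The natural functors between the `𝒞^hol_T` for two monoid types ("intrinsically defined": same
structure-orbispace and CAF, the arithmetic datum re-formed inside `k`; on morphisms the restriction of
the one field isomorphism `κ₂⁻¹ ∘ 𝒜_{φ_𝕏} ∘ κ₁`, `changeType_map_arith_coe`) — the common shape of the three
printed functors `toTLG`, `toTCG`, `unitsTCG` below. [cite: MochizukiAbsTopIII2015, Definition 4.1 (iii) p.103] -/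
def changeType {T' : ArchPairType} (hT' : T'.IsMonoidType) : HolMonoidPair 𝔄 T ⥤ HolMonoidPair 𝔄 T' where
  obj P := ⟨P.toHolTFPair, hT'⟩
  map φ := Hom.ofBase _ _ φ.base
  map_id _ := Hom.ext_of_base rfl
  map_comp _ _ := Hom.ext_of_base rfl

/-- The type-change functors agree with `φ_M` on common elements of the arithmetic data (restriction /
unique extension to the groupification inside `k`). [cite: MochizukiAbsTopIII2015, Definition 4.1 (iii) p.103] -/
theorem changeType_map_arith_coe {T' : ArchPairType} (hT' : T'.IsMonoidType) {P Q : HolMonoidPair 𝔄 T}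
    (φ : P ⟶ Q) (m : P.M) (m' : (HolMonoidPair.mk P.toHolTFPair hT' : HolMonoidPair 𝔄 T').M)
    (hmm' : m.1 = m'.1) :
    (φ.arith m).1 = (((changeType 𝔄 hT').map φ).arith m').1 := by
  rw [Hom.arith_coe, hmm']
  rfl

/-- Type change keeps the structure-orbispace. [cite: MochizukiAbsTopIII2015, Definition 4.1 (iii) p.103] -/
theorem changeType_comp_toEA {T' : ArchPairType} (hT' : T'.IsMonoidType) :
    changeType 𝔄 (T := T) hT' ⋙ toEA 𝔄 T' = toEA 𝔄 T := rfl

/-- `𝒞^hol_TF → 𝒞^hol_T → 𝒞^hol_T'` is `𝒞^hol_TF → 𝒞^hol_T'` ("various compatible natural functors").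
[cite: MochizukiAbsTopIII2015, Definition 4.1 (iii) p.103] -/
theorem ofTF_comp_changeType (hT : T.IsMonoidType) {T' : ArchPairType} (hT' : T'.IsMonoidType) :
    ofTF 𝔄 hT ⋙ changeType 𝔄 hT' = ofTF 𝔄 hT' := rfl

variable (𝔄) in
/-- **Def 4.1 (iii): `𝒞^hol_TM → 𝒞^hol_TLG`**, "the associated groupification `M^gp` of the arithmetic data `M`"
(`(𝒪_k^⊳)^gp = k^×` inside `k`, `ArchPairType.exists_div_eq_of_mem_TLG`). [cite: MochizukiAbsTopIII2015, Definition 4.1 (iii) p.103] -/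
def toTLG : HolMonoidPair 𝔄 .TM ⥤ HolMonoidPair 𝔄 .TLG := changeType 𝔄 ArchPairType.isMonoidType_TLG

variable (𝔄) in
/-- **Def 4.1 (iii): `𝒞^hol_TM → 𝒞^hol_TCG`**, "the subgroup of invertible elements `M^×` of the arithmetic data
`M`" (`(𝒪_k^⊳)^× = 𝒪_k^×`). [cite: MochizukiAbsTopIII2015, Definition 4.1 (iii) p.103] -/
def toTCG : HolMonoidPair 𝔄 .TM ⥤ HolMonoidPair 𝔄 .TCG := changeType 𝔄 ArchPairType.isMonoidType_TCG

variable (𝔄) in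
/-- **Def 4.1 (iii): `𝒞^hol_TLG → 𝒞^hol_TCG`**, "the maximal compact subgroup of the arithmetic data"
(`𝒪_k^× ⊆ k^×`; maximality: abc-iut-L4-t14's `Rmk_2_7_2`). [cite: MochizukiAbsTopIII2015, Definition 4.1 (iii) p.103] -/
def unitsTCG : HolMonoidPair 𝔄 .TLG ⥤ HolMonoidPair 𝔄 .TCG := changeType 𝔄 ArchPairType.isMonoidType_TCG

/-- Compatibility `𝒞^hol_TM → 𝒞^hol_TLG → 𝒞^hol_TCG = 𝒞^hol_TM → 𝒞^hol_TCG`. [cite: MochizukiAbsTopIII2015, Definition 4.1 (iii) p.103] -/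
theorem toTLG_comp_unitsTCG : toTLG 𝔄 ⋙ unitsTCG 𝔄 = toTCG 𝔄 := rfl

/-- On `𝒪_k^× ⊆ 𝒪_k^⊳` the functor `𝒞^hol_TM → 𝒞^hol_TCG` RESTRICTS `φ_M`.
[cite: MochizukiAbsTopIII2015, Definition 4.1 (iii) p.103] -/
theorem toTCG_map_arith_coe {P Q : HolMonoidPair 𝔄 .TM} (φ : P ⟶ Q)
    (u : (HolMonoidPair.mk P.toHolTFPair ArchPairType.isMonoidType_TCG : HolMonoidPair 𝔄 .TCG).M) :
    (φ.arith ⟨u.1, ArchPairType.arithSubmonoid_TCG_le_TM u.2⟩).1 = (((toTCG 𝔄).map φ).arith u).1 :=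
  changeType_map_arith_coe ArchPairType.isMonoidType_TCG φ ⟨u.1, ArchPairType.arithSubmonoid_TCG_le_TM u.2⟩ u rfl

/-- On `𝒪_k^⊳ ⊆ k^×` the functor `𝒞^hol_TM → 𝒞^hol_TLG` EXTENDS `φ_M` (to the groupification).
[cite: MochizukiAbsTopIII2015, Definition 4.1 (iii) p.103] -/
theorem toTLG_map_arith_coe {P Q : HolMonoidPair 𝔄 .TM} (φ : P ⟶ Q) (m : P.M) :
    (φ.arith m).1 = (((toTLG 𝔄).map φ).arith
      (⟨m.1, ArchPairType.arithSubmonoid_TM_le_TLG m.2⟩ :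
        (HolMonoidPair.mk P.toHolTFPair ArchPairType.isMonoidType_TLG : HolMonoidPair 𝔄 .TLG).M)).1 :=
  changeType_map_arith_coe ArchPairType.isMonoidType_TLG φ m ⟨m.1, ArchPairType.arithSubmonoid_TM_le_TLG m.2⟩ rfl

/-! ### Def 4.1 (iv): `𝔩𝔬𝔤_{TF,T}` for the monoid types -/

variable (𝔄) in
/-- **Def 4.1 (iv): `𝔩𝔬𝔤_{TF,T} : 𝒞^hol_TF → 𝒞^hol_T`** for `T ∈ {TLG, TCG, TM}`: "by composing `𝔩𝔬𝔤_{TF,TF}` with the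
various natural functors defined in (iii)" (abc-iut-L4-t10's `HolTFPair.logFunctor`, the identity in the
tree's realisation `k~ = (k, +)`). [cite: MochizukiAbsTopIII2015, Definition 4.1 (iv) p.104] -/
def logTF (hT : T.IsMonoidType) : HolTFPair 𝔄 ⥤ HolMonoidPair 𝔄 T :=
  HolTFPair.logFunctor 𝔄 ⋙ ofTF 𝔄 hT

/-! ### Proposition 4.2 (ii): the factorisation through `𝒞^hol_TM` and `𝔩𝔬𝔤_{TM,TM} ≅ 𝟭` -/

variable (𝔄) in
/-- **Prop 4.2 (ii): `𝔩𝔬𝔤_{TM,TF} : 𝒞^hol_TM → 𝒞^hol_TF`** — "the equivalence of categories `κ_LH : EA ⥲ LinHol` of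
Definition 4.1, (v) — i.e., the functorial algorithms of Corollary 2.7 — determines" it: forget to `𝕏`,
reconstruct `(𝕏, 𝕏 ↶ 𝒜_𝕏)` by `κ_LH`, pass to `𝒞^hol_TF` by `φ_LH`, apply `𝔩𝔬𝔤_{TF,TF}`.
[cite: MochizukiAbsTopIII2015, Proposition 4.2 (ii) p.105] -/
def logTMTF : HolMonoidPair 𝔄 .TM ⥤ HolTFPair 𝔄 :=
  toEA 𝔄 .TM ⋙ LinHol.κLH 𝔄 ⋙ LinHol.φLH 𝔄 ⋙ HolTFPair.logFunctor 𝔄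

variable (𝔄) in
/-- **Prop 4.2 (ii): `𝔩𝔬𝔤_{TM,T} : 𝒞^hol_TM → 𝒞^hol_T`** for `T ∈ {TLG, TCG, TM}` (`𝔩𝔬𝔤_{TM,TF}` followed by the natural
functor of Def 4.1 (iii)). [cite: MochizukiAbsTopIII2015, Proposition 4.2 (ii) p.105] -/
def logTM (hT : T.IsMonoidType) : HolMonoidPair 𝔄 .TM ⥤ HolMonoidPair 𝔄 T :=
  logTMTF 𝔄 ⋙ ofTF 𝔄 hT

/-- `𝔩𝔬𝔤_{TM,TF}` at an object is `(𝕏 ↶ 𝒜_𝕏)`. [cite: MochizukiAbsTopIII2015, Proposition 4.2 (ii) p.105] -/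
theorem logTMTF_obj (P : HolMonoidPair 𝔄 .TM) : (logTMTF 𝔄).obj P = (HolTFPair.ofEA 𝔄).obj P.X := rfl

variable (𝔄) in
/-- **Prop 4.2 (ii), the factorisation for `T = TF`**: `𝒞^hol_TF → 𝒞^hol_TM →^{𝔩𝔬𝔤_{TM,TF}} 𝒞^hol_TF` is naturally
isomorphic to `𝔩𝔬𝔤_{TF,TF}` (components the tautological `(𝕏 ↶ 𝒜_𝕏) ⥲ (𝕏 ↶ k)`, abc-iut-L4-t10's `etaIso`).
[cite: MochizukiAbsTopIII2015, Proposition 4.2 (ii) p.105] -/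
def logFactorTF :
    ofTF 𝔄 ArchPairType.isMonoidType_TM ⋙ logTMTF 𝔄 ≅ HolTFPair.logFunctor 𝔄 :=
  NatIso.ofComponents (fun P => HolTFPair.etaIso P) (fun {P Q} φ => by
    apply HolTFPair.Hom.ext_of_base
    change φ.base ≫ 𝟙 Q.X = 𝟙 P.X ≫ φ.base
    rw [Category.comp_id, Category.id_comp])

variable (𝔄) in
/-- **Prop 4.2 (ii), the factorisation** `𝒞^hol_TF → 𝒞^hol_TM →^{𝔩𝔬𝔤_{TM,T}} 𝒞^hol_T ≅ 𝔩𝔬𝔤_{TF,T}` for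
`T ∈ {TLG, TCG, TM}`. [cite: MochizukiAbsTopIII2015, Proposition 4.2 (ii) p.105] -/
def logFactor (hT : T.IsMonoidType) :
    ofTF 𝔄 ArchPairType.isMonoidType_TM ⋙ logTM 𝔄 hT ≅ logTF 𝔄 hT :=
  Functor.isoWhiskerRight (logFactorTF 𝔄) (ofTF 𝔄 hT)

variable (𝔄) in
/-- **Prop 4.2 (ii): "[when `T ∈ {TF, TM}`] the functor `𝔩𝔬𝔤_{T,T}` is isomorphic to the identity functor"** —
the case `T = TM` (the case `T = TF` is abc-iut-L4-t10's `logFunctor = 𝟭`): components the isomorphisms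
`(𝕏 ↶ 𝒪^⊳_{𝒜_𝕏}) ⥲ (𝕏 ↶ 𝒪_k^⊳)` over `id_𝕏`. [cite: MochizukiAbsTopIII2015, Proposition 4.2 (ii) p.106] -/
def logTMIsoId :
    logTM 𝔄 ArchPairType.isMonoidType_TM ≅ 𝟭 (HolMonoidPair 𝔄 .TM) :=
  NatIso.ofComponents (fun P => etaIso P) (fun {P Q} φ => by
    apply Hom.ext_of_base
    change φ.base ≫ 𝟙 Q.X = 𝟙 P.X ≫ φ.base
    rw [Category.comp_id, Category.id_comp])

/-- **Prop 4.2 (ii)**: "hence, in particular, [`𝔩𝔬𝔤_{TM,TM}`] is an equivalence of categories".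
[cite: MochizukiAbsTopIII2015, Proposition 4.2 (ii) p.106] -/
theorem logTM_TM_isEquivalence : (logTM 𝔄 ArchPairType.isMonoidType_TM).IsEquivalence :=
  Functor.isEquivalence_of_iso (logTMIsoId 𝔄).symm

/-- `𝔩𝔬𝔤_{TM,T}` is an equivalence for every monoid type `T` (it is `𝔩𝔬𝔤_{TM,TM}` followed by the equivalence
`𝒞^hol_TM → 𝒞^hol_T`). [cite: MochizukiAbsTopIII2015, Proposition 4.2 (ii) p.106] -/
theorem logTM_isEquivalence (hT : T.IsMonoidType) : (logTM 𝔄 hT).IsEquivalence := by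
  haveI := toEA_isEquivalence (𝔄 := 𝔄) ArchPairType.isMonoidType_TM
  haveI := LinHol.κLH_isEquivalence 𝔄
  haveI := LinHol.φLH_isEquivalence 𝔄
  haveI : (HolTFPair.logFunctor 𝔄).IsEquivalence := Functor.isEquivalence_refl
  haveI := ofTF_isEquivalence (𝔄 := 𝔄) hT
  unfold logTM logTMTF
  infer_instance

end HolMonoidPair

end Literature.AnabelianGeometry.AbsoluteAnabelian

end
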